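import Literature.NumberTheory.GelbartRogawski1991.LocalDoubledDeltaFunctionalNondegenerate
import Literature.NumberTheory.GelbartRogawski1991.LocalDoubledUnitarySplittingDataCM
import Literature.RepresentationTheory.HeisenbergGroup.DoubledDeltaInvariantFunctional

/-!
# The doubled parabolic functional does not vanish on the doubled vacuum: `λ_Δ(1_{𝒪^{n+n}}) ≠ 0`, and at a good place with an integral
# swap `λ′(1_{𝒪^n} ⊠ 1_{𝒪^n}) ≠ 0` (LOCAL SEAM of s23, inert package, organ (L24-b) (Λ-b))

Track B ∕ K2-LIT, hLiu418 = stmt-HodgeConjecture-24832; LEAD F0P6-plan (g11) «M-155g» (ii) ∕ «M-155i» ((L24-b) by ROAD A′, the «one new analytic input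
`λ′(𝟙_{𝒪^{2n′}}) ≠ 0`» — here shown ★-DERIVABLE, census K2 bus 2026-09-04).  Helper (count-neutral, own head per LEAD R3).  THEOREMS ONLY (no `def`,
no instance, no notation, no named fact, no `sorry`).

* §1 (any number field `F`, any `T₀ ∈ GL_n(F)`, any mover `m₀ : ℓ_Δ → ℓ_Y`) **`apply_zero_toRep_unitVec_ne_zero`**: `(ω^𝔻(m₀) 1_{𝒪_v^{n+n}})(0) ≠ 0`.
  PROOF: `λ_Δ := ev₀ ∘ ω^𝔻(m₀)` is invariant under the Heisenberg lift of the diagonal Lagrangian `ℓ_Δ` (★ `apply_zero_toRep_schrodinger_of_mem_deltaLagrangian`),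
  hence by the tree's LOCAL LI IDENTITY ★ `HeisenbergGroup.exists_eq_mul_diagIntegral_of_forall_deltaW` (docked through ★ `localGram_gramD`) it is `c · ∫ Φ(u ⊔ u) dμ`
  with `c ≠ 0` (★ `apply_zero_toRep_ne_zero`); and `∫ 1_{𝒪^{n+n}}(u ⊔ u) dμ = μ(𝒪_v^n) > 0`.
* §2 (the doubled CM datum `s^𝔻 = (localSplittingDatumCM L v μ n hT₀ hT₀d rfl χ hχ).localSplitting`, `λ′ = ev₀ ∘ ω^𝔻(m₀ · s^𝔻 w₀)`)
  **`apply_zero_toRep_mul_localSplitting_boxSB_unitVec_ne_zero`**: at a GOOD place (★ `IsGoodPlace`) and for `w₀ ∈ H(𝒪_v)`,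
  `λ′(1_{𝒪^n} ⊠ 1_{𝒪^n}) ≠ 0` — `1 ⊠ 1 = 1_{𝒪^{n+n}}` (★ `unitVec_eq_boxSB`) is fixed by `ω^𝔻(s^𝔻 w₀)` (★ `localSplittingDatumCM_unramified`), then §1.  This is the
  hypothesis `hne` of ★ (Λ-a) `K2LiuDoublingEigenfunctionalUpstairs.eq_sum_scalar_of_sum_toRep_localSplittingCMWith_eq_smul` at `f = f₂ = 1_{𝒪^n}`.
Why the cheaper-looking route fails (recorded): ★ non-degeneracy of `λ_Δ` in the first slot does not pass through `ω^𝔻(w₀)` — `w₀Δ = ℓ_y ⊕ ℓ_y⁻` is a boundary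
Lagrangian, `λ′` restricted to products is `λ_{ℓ_y} ⊗ λ_{ℓ_y⁻}`; the `H(𝒪_v)`-fixedness of the doubled vacuum is what evaluates it.
[Kudla1994, §3 Thm. 3.1]; [Li1992, (13) pp. 181–182]; [MoeglinVignerasWaldspurger1987, Chap. 2 II.6, II.10]; [GelbartRogawski1991, §3.1 (3.1.3) p. 456].
HONEST LABEL: HC_CM is proved only modulo the printed citations (2 remaining named inputs: hLiu418 = stmt-HodgeConjecture-24832, h413 =
stmt-HodgeConjecture-24833) until rung 0 closes; this file is unconditional and moves no counter.
-/

set_option autoImplicit false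

set_option linter.dupNamespace false

noncomputable section

open scoped Matrix
open NumberField IsDedekindDomain MeasureTheory Matrix
open Literature.RepresentationTheory.HeisenbergGroup
open Literature.NumberTheory.Automorphic Literature.NumberTheory.Automorphic.UnitaryGroup Literature.NumberTheory.Weil1964
open Literature.NumberTheory.GaloisRepresentations Literature.RepresentationTheory.HarrisKudlaSweet1996
open Literature.NumberTheory.GelbartRogawski1991 Literature.NumberTheory.GelbartRogawski1991.UnitaryDualPair
open Literature.NumberTheory.GelbartRogawski1991.UnitaryDualPair.LocalSplitting

namespace Summit.HodgeConjecture.HodgeConjecture.Cruxes.HLiu418.K2LiuDoublingEigenfunctionalNonvanishing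

/-! ## §1 `λ_Δ(1_{𝒪^{n+n}}) ≠ 0` for every mover `m₀ : ℓ_Δ → ℓ_Y` -/

section Delta

variable (F : Type) [Field F] [NumberField F] (v : HeightOneSpectrum (𝓞 F)) (n : ℕ) {T₀ : Matrix (Fin n) (Fin n) F}
  (hT₀d : IsUnit T₀.det) (m₀ : LocalMp F (n + n) (gramD F n T₀) v)
  (hm₀ : (deltaLagrangian F v n).map (toLin F v (MpPsi.proj _ m₀)) = lagrangianY F (n + n) v)

/-- the Heisenberg lift `((α ⊔ α, β ⊔ β), 0)` of a diagonal pair lies over `ℓ_Δ`. [cite: Kudla1994, §2 (doubled space, Siegel parabolic)] -/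
theorem deltaW_mem_deltaLagrangian (α β : Fin n → v.adicCompletion F) :
    deltaW (e₂ n) α β ∈ deltaLagrangian F v n := by
  rw [mem_deltaLagrangian_iff]
  refine ⟨funext fun i => ?_, funext fun i => ?_⟩
  · simp only [halfL, halfR, deltaW_fst, glue_apply_inl, glue_apply_inr]
  · simp only [halfL, halfR, deltaW_snd, glue_apply_inl, glue_apply_inr]

/-- the doubled vacuum restricted to the diagonal is the vacuum: `1_{𝒪^{n+n}}(u ⊔ u) = 1_{𝒪^n}(u)`. [cite: GelbartRogawski1991, §3.1 (3.1.3) p. 456] -/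
theorem unitVec_glue_self (u : Fin n → v.adicCompletion F) :
    ((unitVec F (Fin (n + n)) v : SchwartzBruhat (Fin (n + n) → v.adicCompletion F)) : (Fin (n + n) → v.adicCompletion F) → ℂ)
        (glue (e₂ n) u u) =
      (integralBox F (Fin n) v).indicator (fun _ => (1 : ℂ)) u := by
  rw [coe_unitVec]
  by_cases hu : u ∈ integralBox F (Fin n) v
  · rw [Set.indicator_of_mem hu, Set.indicator_of_mem]
    rw [mem_integralBox_iff] at hu ⊢
    intro k
    obtain ⟨i, rfl⟩ := (e₂ n).surjective k
    rcases i with i | i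
    · rw [glue_apply_inl]; exact hu i
    · rw [glue_apply_inr]; exact hu i
  · rw [Set.indicator_of_notMem hu, Set.indicator_of_notMem]
    intro hmem
    apply hu
    rw [mem_integralBox_iff] at hmem ⊢
    intro i
    have h := hmem (e₂ n (Sum.inl i))
    rwa [glue_apply_inl] at h

include hT₀d hm₀ in
set_option maxHeartbeats 800000 in -- measured 2026-09-04: the local Li identity's telescope (`exists_eq_mul_diagIntegral_of_forall_deltaW` over the doubled datum)
/-- **`λ_Δ(1_{𝒪_v^{n+n}}) ≠ 0`**: `(ω^𝔻(m₀) 1_{𝒪^{n+n}})(0) ≠ 0` for every implementer `m₀` carrying `ℓ_Δ` onto `ℓ_Y` — by the tree's local Li identity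
`λ_Δ = c · ∫ Φ(u ⊔ u) dμ` (`c ≠ 0`) and `∫ 1_{𝒪^{n+n}}(u ⊔ u) dμ = μ(𝒪_v^n) > 0`. [cite: Li1992, (13) pp. 181–182]
[cite: MoeglinVignerasWaldspurger1987, Chap. 2 II.6] [cite: Kudla1994, §3 Thm. 3.1] -/
theorem apply_zero_toRep_unitVec_ne_zero :
    ((MpPsi.toRep (localSchrodinger F (n + n) (gramD F n T₀) v) m₀ (unitVec F (Fin (n + n)) v) :
        SchwartzBruhat (Fin (n + n) → v.adicCompletion F)) : (Fin (n + n) → v.adicCompletion F) → ℂ) 0 ≠ 0 := by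
  classical
  -- Haar data on `F_v^n`
  letI : MeasurableSpace (v.adicCompletion F) := borel _
  haveI : BorelSpace (v.adicCompletion F) := ⟨rfl⟩
  haveI := secondCountableTopology_adicCompletion F v
  haveI : CharZero (v.adicCompletion F) := charZero_of_injective_algebraMap (algebraMap F (v.adicCompletion F)).injective
  haveI : Invertible (2 : v.adicCompletion F) := invertibleOfNonzero two_ne_zero
  obtain ⟨μ, hμ⟩ : ∃ μ : Measure (Fin n → v.adicCompletion F), μ = Measure.addHaar := ⟨_, rfl⟩
  haveI : μ.IsAddHaarMeasure := hμ ▸ inferInstance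
  -- `λ_Δ` as a linear functional, its `ℓ_Δ`-invariance, the local Li identity
  obtain ⟨lam, hlam⟩ := exists_linearMap_apply_zero_toRep F v n m₀
  -- the local Schrödinger model of the doubled datum IS the Heisenberg-group files' `schrodingerSB` (definitional)
  have hdef : localSchrodinger F (n + n) (gramD F n T₀) v =
      schrodingerSB (Matrix.toLinearMap₂' (v.adicCompletion F) (localGram F (n + n) (gramD F n T₀) v)) (adeleAddCharAt F v)
        (isLocallyConstant_of_isContinuousNontrivial (isContinuousNontrivial_adeleAddCharAt F v))
        (continuous_toLinearMap₂'_left (localGram F (n + n) (gramD F n T₀) v)) := rfl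
  have hΛ : ∀ (α β : Fin n → v.adicCompletion F) (Φ : SchwartzBruhat (Fin (n + n) → v.adicCompletion F)),
      lam (schrodingerSB (Matrix.toLinearMap₂' (v.adicCompletion F) (localGram F (n + n) (gramD F n T₀) v)) (adeleAddCharAt F v)
        (isLocallyConstant_of_isContinuousNontrivial (isContinuousNontrivial_adeleAddCharAt F v))
        (continuous_toLinearMap₂'_left (localGram F (n + n) (gramD F n T₀) v)) ⟨deltaW (e₂ n) α β, 0⟩ Φ) = lam Φ := by
    intro α β Φ
    have h := apply_zero_toRep_schrodinger_of_mem_deltaLagrangian F v n T₀ m₀ hm₀ ⟨deltaW (e₂ n) α β, 0⟩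
      (deltaW_mem_deltaLagrangian F v n α β) Φ
    have h1 : (((adeleAddCharAt F v) (⟨deltaW (e₂ n) α β, 0⟩ : Heisenberg (polar (localPairing F (n + n) (gramD F n T₀) v))).t :
        Circle) : ℂ) = 1 := by
      rw [show (⟨deltaW (e₂ n) α β, 0⟩ : Heisenberg (polar (localPairing F (n + n) (gramD F n T₀) v))).t = 0 from rfl,
        AddChar.map_zero_eq_one, Circle.coe_one]
    rw [h1, one_mul] at h
    rw [hlam, hlam, ← hdef]
    exact h
  obtain ⟨c, hc⟩ := exists_eq_mul_diagIntegral_of_forall_deltaW (e₂ n) (T₀.map (algebraMap F (v.adicCompletion F)))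
    (localGram_gramD F v n T₀) (isLocallyConstant_of_isContinuousNontrivial (isContinuousNontrivial_adeleAddCharAt F v))
    (continuous_toLinearMap₂'_left (localGram F (n + n) (gramD F n T₀) v)) μ (isContinuousNontrivial_adeleAddCharAt F v)
    (isUnit_det_map (algebraMap F (v.adicCompletion F)) hT₀d) lam hΛ
  -- `c ≠ 0`
  have hc0 : c ≠ 0 := by
    intro h0
    obtain ⟨Φ, hΦ⟩ := apply_zero_toRep_ne_zero F (n + n) (gramD F n T₀) v m₀
    apply hΦ
    rw [← hlam, hc, h0, zero_mul]
  -- the diagonal integral of the doubled vacuum is `μ(𝒪_v^n)`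
  have hdiag : diagIntegral (e₂ n) μ (unitVec F (Fin (n + n)) v) = ((μ.real (integralBox F (Fin n) v) : ℝ) : ℂ) := by
    rw [diagIntegral_apply]
    simp_rw [unitVec_glue_self F v n]
    rw [integral_indicator_const (1 : ℂ) (isOpen_integralBox F (Fin n) v).measurableSet, Complex.real_smul, mul_one]
  have hpos : μ.real (integralBox F (Fin n) v) ≠ 0 :=
    (ENNReal.toReal_pos ((isOpen_integralBox F (Fin n) v).measure_pos μ ⟨0, zero_mem_integralBox F (Fin n) v⟩).ne'
      (isCompact_integralBox F (Fin n) v).measure_lt_top.ne).ne'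
  rw [← hlam, hc, hdiag]
  exact mul_ne_zero hc0 (Complex.ofReal_ne_zero.2 hpos)

end Delta

/-! ## §2 The CM datum at a good place: `λ′(1_{𝒪^n} ⊠ 1_{𝒪^n}) ≠ 0` for an integral swap `w₀` -/

section CM

variable (L : Type) [Field L] [NumberField L] [IsCMField L] (v : HeightOneSpectrum (𝓞 (maximalRealSubfield L)))
  [MeasurableSpace (v.adicCompletion (maximalRealSubfield L))] [BorelSpace (v.adicCompletion (maximalRealSubfield L))]
  (μ : Measure (v.adicCompletion (maximalRealSubfield L))) [μ.IsAddHaarMeasure]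
  (n : ℕ) {T₀ : Matrix (Fin n) (Fin n) (maximalRealSubfield L)} (hT₀ : T₀.IsSymm) (hT₀d : IsUnit T₀.det)
  (χ : HeckeCharacter L) (hχ : IsSplittingChar L 1 χ)
  (m₀ : LocalMp (maximalRealSubfield L) (n + n) (gramD (maximalRealSubfield L) n T₀) v)
  (hm₀ : (deltaLagrangian (maximalRealSubfield L) v n).map (toLin (maximalRealSubfield L) v (MpPsi.proj _ m₀)) =
    lagrangianY (maximalRealSubfield L) (n + n) v)
  (w₀ : UnitaryGroup.localPi L (IsCMField.complexConj L) (n + n)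
    ((gramD (maximalRealSubfield L) n T₀).map (algebraMap (maximalRealSubfield L) L)) v)

include hm₀ in
set_option maxHeartbeats 4000000 in -- the doubled CM datum's telescope (as ★ `LocalSplittingCMParabolicEigenfunctional`)
/-- **`λ′(1_{𝒪^n} ⊠ 1_{𝒪^n}) ≠ 0` AT A GOOD PLACE FOR AN INTEGRAL SWAP** (`λ′ = ev₀ ∘ ω^𝔻(m₀ · s^𝔻 w₀)`, `w₀ ∈ H(𝒪_v)`): the doubled vacuum
`1 ⊠ 1 = 1_{𝒪^{n+n}}` is fixed by `ω^𝔻(s^𝔻 w₀)` (★ `localSplittingDatumCM_unramified`) and `λ_Δ(1_{𝒪^{n+n}}) ≠ 0` (§1) — the hypothesis `hne` of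
★ (Λ-a) `eq_sum_scalar_of_sum_toRep_localSplittingCMWith_eq_smul` at `f = f₂ = 1_{𝒪^n}`. [cite: GelbartRogawski1991, §3.1 (3.1.3) p. 456]
[cite: Kudla1994, §3 Thm. 3.1] [cite: Li1992, (13) pp. 181–182] -/
theorem apply_zero_toRep_mul_localSplitting_boxSB_unitVec_ne_zero
    (hgood : IsGoodPlace (maximalRealSubfield L) L (imagUnit L) v n T₀ (fun w' : PlacesOver L v => (χ.localComponent w'.1)⁻¹))
    (hw₀K : w₀ ∈ UnitaryGroup.localInt L (IsCMField.complexConj L) (n + n)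
      ((gramD (maximalRealSubfield L) n T₀).map (algebraMap (maximalRealSubfield L) L)) v) :
    ((MpPsi.toRep (localSchrodinger (maximalRealSubfield L) (n + n) (gramD (maximalRealSubfield L) n T₀) v)
          (m₀ * (localSplittingDatumCM L v μ n hT₀ hT₀d rfl χ hχ).localSplitting w₀)
          (boxSB (v.adicCompletion (maximalRealSubfield L)) (e₂ n) (unitVec (maximalRealSubfield L) (Fin n) v)
            (unitVec (maximalRealSubfield L) (Fin n) v)) :
        SchwartzBruhat (Fin (n + n) → v.adicCompletion (maximalRealSubfield L))) :
        (Fin (n + n) → v.adicCompletion (maximalRealSubfield L)) → ℂ) 0 ≠ 0 := by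
  have hfix : MpPsi.toRep (localSchrodinger (maximalRealSubfield L) (n + n) (gramD (maximalRealSubfield L) n T₀) v)
      ((localSplittingDatumCM L v μ n hT₀ hT₀d rfl χ hχ).localSplitting w₀) (unitVec (maximalRealSubfield L) (Fin (n + n)) v) =
      unitVec (maximalRealSubfield L) (Fin (n + n)) v :=
    localSplittingDatumCM_unramified L v μ n hT₀ hT₀d rfl χ hχ hgood w₀ hw₀K
  rw [← unitVec_eq_boxSB, map_mul, Module.End.mul_apply, hfix]
  exact apply_zero_toRep_unitVec_ne_zero (maximalRealSubfield L) v n hT₀d m₀ hm₀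

end CM

end Summit.HodgeConjecture.HodgeConjecture.Cruxes.HLiu418.K2LiuDoublingEigenfunctionalNonvanishing

end
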